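import Mathlib.FieldTheory.IsAlgClosed.Basic
import Mathlib.Algebra.Polynomial.Degree.SmallDegree
import Mathlib.Analysis.Complex.Polynomial.Basic
import Mathlib.Tactic.Linarith
import Mathlib.Tactic.NormNum
import Mathlib.Tactic.Ring
import Mathlib.Tactic.IntervalCases
import Mathlib.Tactic.LinearCombination
import HarnessLib

/-!
# The (0,1) cell of the ι-window, XVII: the product ground `B₁ × B₂`, IV — the residual R-PB3 under the microscope:
# the determinant lemma HOM-ONE, the isolated-point reduction ISO-RED, the populated corner of the minimal reading — algebraic skeleton

Family `hodge`, b2b cell `hweil` (helper of item stmt-HodgeConjecture-2524). Report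
`run/shared/lean/b2b/hodge-weil/b2b-hweil-pv1-g29/H2-ZERO-ONE-17.md` (prover 1 gen 29). Companion to
`WeilTypeLadderH2ProductGroundThree.lean` (gen 28: LEMMA AK, LEMMA EE, LEMMA M1, THEOREM PB3, `pg3_*`) and
`WeilTypeLadderH2ProductGroundTwo.lean` (gen 27, `pgt_*`). HONEST FRAMING: census results inside the ladder's H2 test ((0,1) cell) on the
SPECIAL fourfold `X₀ = B₁ × B₂`; by the cell's THEOREM U5 an object there would decide H2 positively, emptiness of a family there is a
census line and nothing more. No case of the Hodge conjecture is proved; nothing here is a rung; no statement of [Markman 2025] /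
[Perry 2026] / [EdGFS 2025] is used. The kernel content is the elementary algebra and arithmetic of the report; the geometry (μ-stability on
an abelian surface with `NS = ℤθ`, Mukai's moduli of simple sheaves, cohomology and base change, LEMMA M1) is quoted print and the cell's
certified items.

## THEOREM HOM-ONE (report §1)

For torsion-free sheaves `X, Y` of the SAME rank `r` on a surface, `φ ↦ det φ ∈ H⁰(det Y ⊗ det X⁻¹)` is a form of degree `r` on `Hom(X,Y)`.
If `h⁰(det Y ⊗ det X⁻¹) ≤ 1` and `hom(X,Y) ≥ 2`, the restriction of `det` to a pencil is a binary form of degree `r` with values in a line,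
which has a non-trivial zero over `ℂ` (`pg4_binary_quadratic_isotropic` is the case `r = 2` used in the report; `pg4_root_of_dehomogenised`
is the general mechanism): a non-zero `φ` of rank `< r`, whose image is a torsion-free sheaf of rank `s`, `0 < s < r`, with
`μ(X) < μ(image) < μ(Y)` by μ-stability. On a ppas with `NS = ℤθ` (`θ² = 2`) slopes of rank-`s` sheaves are `2m/s`; for the two jump pairs of
R-PB3 in reading `W` — `(N', E)`: ranks `(2,2)`, slopes `(0,1)`; `(E', N)`: ranks `(2,2)`, slopes `(1,2)` — the image would have rank `1` and EVEN
integral slope strictly inside `(0,1)` resp. `(1,2)`: none (`pg4_window_01`, `pg4_window_12`). Hence `hom ≤ 1` (`pg4_hom_le_one`), while the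
engine's corner needs `hom⁺ = hom⁻ = 1`, i.e. `hom = 2` (`pg4_corner_needs_two`): the corner is EMPTY for the named sheaves of reading `W`.
`pg4_equal_rank_directions` / `pg4_dir_W_not_bipositive` / `pg4_dir_12_not_bipositive`: the determinant lemma applies to a jump pair exactly in
the two directions `(a,b) ∈ {(1,0), (1,−2)}` of the `SL₂(ℤ)`-family of readings, and NEITHER is a bi-positive sheaf reading of the ordered type —
so HOM-ONE does not touch the engine's corner in any of its (infinitely many) bi-positive readings (report §4).

## THEOREM ISO-RED and PROPOSITION POP (report §§2–3)

`pg4_iso_red_bound`: LEMMA M1's bound `e₁^ι(F) ≥ (G − 1) + dim ker d^ι` with `G = 2` and one kernel vector gives `≥ 2` (VOID). The kernel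
vector exists as soon as the balanced factor is NOT an isolated point of its double-sign jump locus (cohomology and base change along a curve
of the locus). `pg4_branch_signs`: at a node of a symmetric curve sitting at a half-period the local index of `ν_*𝒢̃` is `2ε₁ + 2ε₂`, so
balancedness FORCES opposite signs on the two branches — the eigen-splitting `(1,1)` of the corner is automatic on the 4-dimensional nodal
family of the minimal reading; `pg4_quotient_genus_two`, `pg4_quotient_genus_one`, `pg4_degree_Gtilde`, `pg4_degree_Mprime`,
`pg4_hom_count_reading_one`: the Riemann–Hurwitz / Riemann–Roch bookkeeping of that family (report §3).
-/

-- mandated namespace `Summit.HodgeConjecture.HodgeConjecture.…` (Problem = Summit) trips `linter.dupNamespace`; the lakefile disables it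
-- tree-wide (weak option), restated here so stand-alone elaboration is warning-free too.
set_option linter.dupNamespace false

namespace Summit.HodgeConjecture.HodgeConjecture.WeilTypeLadder

section ProductGroundFour

open Polynomial

/-! ### THEOREM HOM-ONE — the determinant lemma (report §1) -/

/-- **Binary quadratic forms are isotropic over an algebraically closed field (report §1.1, the case `r = 2` of HOM-ONE).**
For `X, Y` torsion-free of rank `2`, `det(xφ₁ + yφ₂) = (a x² + b x y + c y²)·σ₀` once `h⁰(det Y ⊗ det X⁻¹) = 1`; a non-trivial zero
`(x, y)` is a non-zero map `xφ₁ + yφ₂` of rank `≤ 1`. Proof: if `a = 0` take `(1,0)`; otherwise `a t² + b t + c` has a root `t` and `(t,1)`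
works. [elementary; the geometric use is report §1.2] -/
theorem pg4_binary_quadratic_isotropic {k : Type*} [Field k] [IsAlgClosed k] (a b c : k) :
    ∃ x y : k, (x ≠ 0 ∨ y ≠ 0) ∧ a * x ^ 2 + b * x * y + c * y ^ 2 = 0 := by
  by_cases ha : a = 0
  · exact ⟨1, 0, Or.inl one_ne_zero, by simp [ha]⟩
  · have hdeg : (C a * X ^ 2 + C b * X + C c).degree ≠ 0 := by
      rw [Polynomial.degree_quadratic ha]; decide
    obtain ⟨t, ht⟩ := IsAlgClosed.exists_root _ hdeg
    refine ⟨t, 1, Or.inr one_ne_zero, ?_⟩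
    have h := ht
    simp only [IsRoot.def, eval_add, eval_mul, eval_C, eval_pow, eval_X] at h
    linear_combination h

/-- **The general mechanism of HOM-ONE (report §1.1, rank `r`).** A binary form `F(x,y)` of degree `r ≥ 1` over an algebraically closed
field has a non-trivial zero: either the coefficient of `x^r` vanishes (then `(1,0)` is a zero) or the dehomogenised polynomial `F(t,1)` of
degree `r` has a root. Stated here in the form used: a polynomial of non-zero degree has a root. [Mathlib `IsAlgClosed.exists_root`, recorded
for the report's cross-reference] -/
theorem pg4_root_of_dehomogenised {k : Type*} [Field k] [IsAlgClosed k] (p : k[X]) (hp : p.degree ≠ 0) :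
    ∃ t : k, p.IsRoot t :=
  IsAlgClosed.exists_root p hp

/-- **Slope window `(0,1)` (report §1.2, the pair `(N', E)`).** On a ppas with `NS = ℤθ`, `θ² = 2`, a rank-one torsion-free sheaf has slope
`c₁·θ = 2m`, an even integer; `N'` (rank 2, `c₁ = 0`) has slope `0`, `E` (rank 2, `c₁ = θ`) has slope `1`; μ-stability of both puts the
image of a rank-one map strictly between: `0 < 2m < 1` — impossible. [elementary] -/
theorem pg4_window_01 (m : ℤ) : ¬ (0 < 2 * m ∧ 2 * m < 1) := by
  rintro ⟨h1, h2⟩; omega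

/-- **Slope window `(1,2)` (report §1.2, the mirror pair `(E', N)`).** `E'` has slope `1`, `N` (rank 2, `c₁ = 2θ`) has slope `2`;
`1 < 2m < 2` is impossible. [elementary] -/
theorem pg4_window_12 (m : ℤ) : ¬ (1 < 2 * m ∧ 2 * m < 2) := by
  rintro ⟨h1, h2⟩; omega

/-- **The general window test used by the engine rule (R4) (report §1.3).** For two μ-stable torsion-free sheaves of equal rank `r` with
`c₁(Y) − c₁(X) = θ` on a ppas with `NS = ℤθ` — slopes `2c/r` and `2(c+1)/r` — a rank-`s` image (`0 < s < r`) of slope `2m/s` strictly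
between them means `2cs < 2mr ∧ 2mr < 2(c+1)s`, i.e. `cs < mr < (c+1)s`. For `r = 2`, `s = 1` this reads `c < 2m < c + 1`: impossible for
integers. [elementary] -/
theorem pg4_window_rank_two (c m : ℤ) : ¬ (c < 2 * m ∧ 2 * m < c + 1) := by
  rintro ⟨h1, h2⟩; omega

/-- **HOM-ONE, logical skeleton (report §1.2).** If every two-dimensional space of maps contains a non-zero map of rank `< r`
(isotropy) and no such map exists (the slope window is empty), then `hom ≤ 1`. [elementary bookkeeping of the report's argument] -/
theorem pg4_hom_le_one (h : ℕ) (isotropy : 2 ≤ h → ∃ s : ℕ, 0 < s ∧ s < 2 ∧ False) : h ≤ 1 := by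
  by_contra hh
  obtain ⟨_, _, _, hf⟩ := isotropy (by omega)
  exact hf

/-- **The corner needs `hom = 2` (report §1.2).** The engine's corner of the family `[3,4,4,3]` ([16] 3.4) requires the eigen-dimensions
`hom⁺ = hom⁻ = 1` of the jump pair, hence total dimension `2`, contradicting `hom ≤ 1`. [elementary] -/
theorem pg4_corner_needs_two (hp hm : ℕ) (hcorner : hp = 1 ∧ hm = 1) (hone : hp + hm ≤ 1) : False := by
  obtain ⟨h1, h2⟩ := hcorner; omega

/-- **Euler data of the two jump pairs (report §1.2).** With `⟨u,u'⟩ = 2cc' − rs' − r's` and `χ = −⟨,⟩`: `χ(N', E) = −⟨(2,0,−2),(2,1,−1)⟩ = −6`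
and `χ(E', N) = −⟨(2,1,−1),(2,2,0)⟩ = −6`; so `ext¹ = 6 + hom` in both cases (Ext² vanishes by stability) and the corner's `(4,4)` for
`ext¹(E, N')` is the same condition as `hom(N',E) = (1,1)`. [arithmetic] -/
theorem pg4_chi_jump_pairs :
    -(2 * (0:ℤ) * 1 - 2 * (-1) - 2 * (-2)) = -6 ∧ -(2 * (1:ℤ) * 2 - 2 * 0 - 2 * (-1)) = -6 ∧ (6:ℤ) + 2 = 4 + 4 := by
  norm_num

/-- **Where the determinant lemma applies (report §4.1).** In the reading with first column `(a,b)` the ranks of the `E'`-class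
`(2,1,−1)` and the `N`-class `(2,2,0)` are `q₁ = 2a² + 2ab − b²` and `q₂ = 2a² + 4ab`; they are equal iff `b(b + 2a) = 0`, i.e. `b = 0`
(reading `W` and its twists) or `b = −2a` (direction `(1,−2)`). [elementary; the opposite-sign case `q₁ = −q₂` reads `(b − 3a)² = 13a²`
and has no non-zero integral solution since `13` is not a square — checked by the script `rpb3_readings.py` to height 40 and not restated here] -/
theorem pg4_equal_rank_directions (a b : ℤ) :
    (2 * a ^ 2 + 2 * a * b - b ^ 2 = 2 * a ^ 2 + 4 * a * b) ↔ (b = 0 ∨ b = -2 * a) := by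
  constructor
  · intro h
    have h2 : b * (b + 2 * a) = 0 := by linear_combination -h
    rcases mul_eq_zero.mp h2 with hb | hb
    · exact Or.inl hb
    · exact Or.inr (by linarith)
  · rintro (hb | hb)
    · subst hb; ring
    · subst hb; ring

/-- **Direction `(1,0)` (reading `W`) is not a bi-positive sheaf reading of the ordered type (report §4.1).** The four ranks are
`(−2, −2, 2, −2)` for `(A₁, A₂, B₁, B₂) = ((−2,−1,1), (−2,−2,0), (2,0,−2), (−2,−1,1))`: the `B`-term has ranks of opposite signs, so no joint
sign change makes all four classes positive — `B = (N' ⊠ E')[1]` is a SHIFTED sheaf box (a presentation, not an extension). [arithmetic] -/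
theorem pg4_dir_W_not_bipositive : ¬ ((0:ℤ) < 2 ∧ (0:ℤ) < -2) ∧ ¬ ((2:ℤ) < 0 ∧ (-2:ℤ) < 0) := by
  omega

/-- **Direction `(1,−2)` is not bi-positive either (report §4.1).** `q_u(1,−2) = r − 4c + 4s`: for `A₁ = (−2,−1,1)`: `6`; `A₂ = (−2,−2,0)`:
`6`; `B₁ = (2,0,−2)`: `−6`; `B₂ = (−2,−1,1)`: `6` — again the `B`-term has mixed signs. [arithmetic] -/
theorem pg4_dir_12_not_bipositive :
    (-2:ℤ) - 4 * (-1) + 4 * 1 = 6 ∧ (-2:ℤ) - 4 * (-2) + 4 * 0 = 6 ∧ (2:ℤ) - 4 * 0 + 4 * (-2) = -6 ∧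
      ¬ ((0:ℤ) < -6 ∧ (0:ℤ) < 6) ∧ ¬ ((-6:ℤ) < 0 ∧ (6:ℤ) < 0) := by
  omega

/-! ### THEOREM ISO-RED and PROPOSITION POP (report §§2–3) -/

/-- **ISO-RED's arithmetic (report §2.2).** LEMMA M1 ([16] 2.2): `e₁^ι(F) ≥ (G − 1) + dim ker d^ι`. At the corner `G = 2`; a balanced factor
that is not an isolated point of its double-sign jump locus supplies a non-zero kernel vector (the tangent to a curve of the locus, along which
the gluing class extends by cohomology and base change), so `dim ker d^ι ≥ 1` and `e₁^ι(F) ≥ 2`: VOID. [arithmetic; geometry in the report] -/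
theorem pg4_iso_red_bound (e G kerd : ℕ) (hM1 : G - 1 + kerd ≤ e) (hG : G = 2) (hk : 1 ≤ kerd) : 2 ≤ e := by
  subst hG; omega

/-- **Branch signs at a node sitting at a half-period (report §3.2).** For a symmetric curve `D̂` with an ordinary node at a half-period
`κ̂` the involution preserves the two branches (it is `−1` on the tangent plane) and the local index of `ν_*𝒢̃` at `κ̂` is
`t = 2ε₁ + 2ε₂`, `ε_i = ±1` the fibre signs on the two branches (each smooth branch through a fixed point with odd local parameter contributes
`ε(1 − (−1)) = 2ε`). Balancedness `t = 0` forces `ε₂ = −ε₁`: the two sections of `H⁰(𝒩(Θ_κ)) ≅ 𝒢 ⊗ k(κ̂)` have OPPOSITE eigenvalues — the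
corner's splitting `(1,1)` is automatic. [elementary] -/
theorem pg4_branch_signs (e1 e2 : ℤ) (h1 : e1 = 1 ∨ e1 = -1) (h2 : e2 = 1 ∨ e2 = -1) (ht : 2 * e1 + 2 * e2 = 0) :
    e2 = -e1 := by
  rcases h1 with rfl | rfl <;> rcases h2 with rfl | rfl <;> omega

/-- **Riemann–Hurwitz for the nodal family (report §3.2).** `D̂ ∈ |2Θ₀|` with one node at the half-period `κ̂` has partial normalisation
`D̃` of genus `5 − 1 = 4`; the involution has exactly the two branch points `p₁, p₂` as fixed points, so `2·4 − 2 = 2(2g' − 2) + 2` and the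
quotient `D̃/ι` has genus `g' = 2` — `Pic(D̃)^ι ⊇ 𝒪(p_i) ⊗ π^*Pic⁰(D̃/ι)` is `2`-dimensional. [arithmetic] -/
theorem pg4_quotient_genus_two (g' : ℤ) (h : 2 * 4 - 2 = 2 * (2 * g' - 2) + 2) : g' = 2 := by omega

/-- **Degree of `𝒢̃` (report §3.2).** `χ(ν_*𝒢̃) = χ(𝒢̃) = d + 1 − 4` must be `−2` (class `(0, 2θ, χ = −2)`), so `d = 1`: `𝒢̃ ∈ Pic¹(D̃)^ι`,
e.g. `𝒪(p₁) ⊗ π^*M`, `M ∈ Pic⁰(D̃/ι)`. With `D̂` moving in the net `|2Θ₀ − κ̂|` (dimension `2`) this is the `2 + 2 = 4`-dimensional family of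
PROPOSITION POP (b). [arithmetic] -/
theorem pg4_degree_Gtilde (d : ℤ) (h : d + 1 - 4 = -2) : d = 1 ∧ (2:ℤ) + 2 = 4 := by omega

/-- **Riemann–Hurwitz on the other surface (report §3.3).** `D ∈ |2Θ₀|` through exactly two half-periods `z₁, z₂` of `Z₁` (nodes there) has
partial normalisation `D̃₂` of genus `5 − 2 = 3` on which ι fixes the four branch points; `2·3 − 2 = 2(2g' − 2) + 4` gives `g' = 1`.
[arithmetic] -/
theorem pg4_quotient_genus_one (g' : ℤ) (h : 2 * 3 - 2 = 2 * (2 * g' - 2) + 4) : g' = 1 := by omega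

/-- **Degree bookkeeping for `M` (report §3.3).** `ν^*M ≅ π'^*M' ⊗ 𝒪(p₁ + p₁')` with `deg ν^*M = 6` gives `2·deg M' + 2 = 6`, `deg M' = 2`;
the fibre signs of `M` at the two nodes are then `(−, +)` up to a global sign — DIFFERENT, as the corner's `(4,4)` requires. [arithmetic] -/
theorem pg4_degree_Mprime (d : ℤ) (h : 2 * d + 2 = 6) : d = 2 := by omega

/-- **The Hom count of the minimal reading (report §3.3).** `hom(𝓘_{Z₁}(−Θ_κ), i_*M) = h⁰(D̃_k, ν^*M(Θ_κ)) = 10 + 1 − (5 − k) = 6 + k` when `D`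
passes through exactly `k` of the three half-periods of `Z₁` (nodes, `M` locally free there, `h¹ = 0` since `deg ω = 8 − 2k < 10`); the
corner's value `8 = 4 + 4` forces `k = 2`. [arithmetic] -/
theorem pg4_hom_count_reading_one (k : ℤ) (hk0 : 0 ≤ k) (hk3 : k ≤ 3) :
    (10 + 1 - (5 - k) = 6 + k) ∧ (8 - 2 * k < 10) ∧ (6 + k = 8 ↔ k = 2) := by
  refine ⟨by ring, by omega, by omega⟩

/-- **The Cayley–Bacharach count behind `hom ≥ 2` in the minimal reading (report §3.1).** For a locally free balanced `𝒩` (rank 2, `c₁ = 0`,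
`c₂ = 2`) a section of `𝒩(Θ_κ)` vanishes on a scheme of length `c₂(𝒩(Θ_κ)) = 2 + 0 + 2 = 4` and `χ(𝒩(Θ_κ)) = 0`; `χ(𝓘_Z(−Θ_κ), 𝒩) =
χ(𝒩(Θ_κ)) − 3·rank = −6` recovers the engine's `χ₂ = −6` — the three points of `Z` contribute only to `Ext¹, Ext²`, so the jump
`hom = h⁰(𝒩(Θ_κ)) ≥ 1` is a DIVISORIAL condition (`κ̂ ∈ D̂_𝒩`), not one of codimension `7`. [arithmetic] -/
theorem pg4_reading_one_euler : (2:ℤ) + 0 + 2 = 4 ∧ (0:ℤ) - 3 * 2 = -6 := by norm_num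

/-- **Infinitely many bi-positive readings (report §4.1).** In the direction `(a,b) = (n, n+1)`, `n ≥ 1`, the four classes of the ordered
type have ranks `q_{A₁} = q_{B₂} = −3n² + 1`, `q_{A₂} = −6n² − 4n`, `q_{B₁} = −4n − 2`, all NEGATIVE; after the joint sign change of both
terms all four classes are positive, so every such direction is a bi-positive sheaf reading (ranks `3n² − 1, 6n² + 4n, 4n + 2, 3n² − 1`,
unbounded). The residual family is therefore an infinite union of a priori distinct families of candidate objects. [elementary] -/
theorem pg4_infinitely_many_readings (n : ℤ) (hn : 1 ≤ n) :
    -2 * n ^ 2 + 2 * (-1) * n * (n + 1) + 1 * (n + 1) ^ 2 = -3 * n ^ 2 + 1 ∧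
    -2 * n ^ 2 + 2 * (-2) * n * (n + 1) + 0 * (n + 1) ^ 2 = -6 * n ^ 2 - 4 * n ∧
    2 * n ^ 2 + 2 * 0 * n * (n + 1) + (-2) * (n + 1) ^ 2 = -4 * n - 2 ∧
    -3 * n ^ 2 + 1 < 0 ∧ -6 * n ^ 2 - 4 * n < 0 ∧ -4 * n - 2 < 0 := by
  refine ⟨by ring, by ring, by ring, by nlinarith, by nlinarith, by omega⟩

/-- **The (S1)/(S2) dichotomy for non-locally-free balanced factors (report §1.4, LEMMA SS).** A simple balanced ι-invariant torsion-free
sheaf of class `(2,0,−2)` that is not μ-stable has a saturated rank-one subsheaf of slope `0`; the two pieces `P₁ ⊗ 𝓘_{W₁}`, `P₂ ⊗ 𝓘_{W₂}`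
have `len W₁ + len W₂ = c₂ = 2`, and simplicity excludes `𝓘_{W₂} ⊂ 𝓘_{W₁}`, in particular `(len W₁, len W₂) = (0, 2)`; balancedness
excludes `(1,1)` (two single half-periods with local indices `±4δ` cannot cancel unless equal, and equal is excluded by simplicity). What is
left is `(2, 0)`: `0 → P ⊗ 𝓘_W → N' → P → 0` with `len W = 2`. [arithmetic bookkeeping of the case list; geometry in the report] -/
theorem pg4_ss_case_list (l1 l2 : ℕ) (hsum : l1 + l2 = 2) (h02 : ¬ (l1 = 0 ∧ l2 = 2)) (h11 : ¬ (l1 = 1 ∧ l2 = 1)) :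
    l1 = 2 ∧ l2 = 0 := by omega

/-- **`h⁰ ≤ 1` for the reflexive hull of a non-locally-free rigid factor (report §1.4 (iii)).** For a μ-stable locally free `U` with
`(r, c₁, χ) = (2, θ, 0)` two independent sections of `U ⊗ P` would give `𝒪² ↪ U ⊗ P` with cokernel a line bundle `T` on a theta translate
`C''` (genus 2) of degree `χ(T) − χ(𝒪_{C''}) = 0 − (−1) = 1`, and the kernel `K''` of `(U ⊗ P)|_{C''} → T` has degree `θ² − 1 = 2 − 1 = 1`;
the two sections restrict into `H⁰(K'')`, of dimension `≤ 1` for a degree-1 line bundle on a curve of genus 2, so a combination vanishes on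
`C''` and lies in `H⁰(U ⊗ P(−Θ'')) = 0`. [arithmetic; geometry in the report] -/
theorem pg4_hull_sections (degT degK : ℤ) (hT : degT = 0 - (1 - 2)) (hK : degK = 2 - degT) : degT = 1 ∧ degK = 1 := by omega

end ProductGroundFour

section ProductGroundFourKL

/-! ### PROPOSAL KL — the Kummer-bilinear stratification of reading-W sheaves (report §9, ADDENDA 1–2; appended) -/

/-- **THEOREM KL-SING, parity core (report §9.1′).** On a normal, locally factorial support divisor `Σ ∈ |2θ|` of `X₀ = B₁ × B₂` a rank-one sheaf has
invertible reflexive hull `(aθ₁ + bθ₂)|_Σ` (Lefschetz for `Pic`), so `ch₂ = (aθ₁ + bθ₂)·2θ − 2θ²` has `θ₁²`-coefficient `2a − 2` and `θ₂²`-coefficient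
`2b − 2` — EVEN —, whereas every reading-`W` H2 class has `ch₂ ≡ θ²` with ODD `θ_i²`-coefficients (`1 + 2c` after a twist by `cθ_i`). Hence the support
of a reading-`W` H2-sheaf is never smooth (indeed never normal and locally factorial). [arithmetic; geometry in the report] -/
theorem pg4_kl_sing_parity (a c : ℤ) : 2 * a - 2 ≠ 1 + 2 * c := by omega

/-- **Dimensions of the rank strata (report §9.8 (v)).** The `4 × 4` matrices of rank `≤ r`, projectivised, form a variety of dimension `r(8 − r) − 1`:
`6, 11, 14, 15` for `r = 1, 2, 3, 4` (rank one = the Segre `ℙ³ × ℙ³`, `3 + 3 = 6`; rank four = all of `ℙ¹⁵`). All these directions are ι-invariant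
(every section of `𝒪(2Θ₀) ⊠ 𝒪(2Θ₀)` is even). [arithmetic] -/
theorem pg4_rank_strata_dims :
    1 * (8 - 1) - 1 = (6:ℤ) ∧ 2 * (8 - 2) - 1 = (11:ℤ) ∧ 3 * (8 - 3) - 1 = (14:ℤ) ∧ 4 * (8 - 4) - 1 = (15:ℤ) ∧ (3:ℤ) + 3 = 6 := by
  norm_num

/-- **Critical values of a general pencil in `|2Θ₀|` and the base locus (report §9.8 (ii)).** A general line of planes meets each of the 16 node-planes
of the dual Kummer configuration once and the dual (quartic) surface 4 times: `16 + 4 = 20` singular members, with `Σδ = 16·1 + 4·2 = 24`, matching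
the Euler characteristic of the blown-up surface: `e(B̃) = 0 + 8` (8 = (2θ)² base points blown up) `= 2·(2 − 2·5) + 24` (genus-5 fibres over `ℙ¹`).
The fibre product of two general pencils has `8 · 8 = 64` ordinary double points at (base point) × (base point). [arithmetic] -/
theorem pg4_pencil_critical_values :
    (16:ℤ) + 4 = 20 ∧ (16:ℤ) * 1 + 4 * 2 = 24 ∧ (2:ℤ) * 2 * 2 = 8 ∧ (0:ℤ) + 8 = 2 * (2 - 2 * 5) + 24 ∧ (8:ℤ) * 8 = 64 := by
  norm_num

/-- **The Weil class of a rank-two-stratum candidate (report §9.8 (iv)).** For `F = 𝒪_{Σ_A}(W)`, `W ≡ a₁θ₁ + a₂θ₂ + Σ v_p V_p + Σ h_q H_q` on the fibre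
product `Σ_A = ⋃_t E_t × D_t` (`i_*[V_p] = θ₁²/2`, `i_*[H_q] = θ₂²/2`, `i_*(θ₁|_Σ) = 2θ₁² + 2θ₁θ₂`, `Σ_A²/2 = 2θ²`), the coefficients of `ch₂(i_*F)` on
`(θ₁², θ₁θ₂, θ₂²)` are `(2a₁ − 2 + sv/2, 2a₁ + 2a₂ − 4, 2a₂ − 2 + sh/2)` (`sv = Σv_p`, `sh = Σh_q`); they equal those of `θ² = (1, 2, 1)` iff
`a₁ + a₂ = 3`, `sv = 6 − 4a₁`, `sh = 6 − 4a₂` (stated with the `θ_i²`-equations doubled to stay integral). Example: `(a₁, a₂, sv, sh) = (1, 2, 2, −2)`.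
[arithmetic] -/
theorem pg4_rank_two_weil_class (a₁ a₂ sv sh : ℤ) :
    (2 * (2 * a₁ - 2) + sv = 2 ∧ 2 * a₁ + 2 * a₂ - 4 = 2 ∧ 2 * (2 * a₂ - 2) + sh = 2) ↔
      (a₁ + a₂ = 3 ∧ sv = 6 - 4 * a₁ ∧ sh = 6 - 4 * a₂) := by
  constructor
  · rintro ⟨h1, h2, h3⟩; refine ⟨by omega, by omega, by omega⟩
  · rintro ⟨h1, h2, h3⟩; refine ⟨by omega, by omega, by omega⟩

/-- **The example class of §9.8 (iv).** `(a₁, a₂) = (1, 2)` with `V_p + V_{−p}` (`sv = 2`) and `−H_q − H_{−q}` (`sh = −2`) satisfies the three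
coefficient equations. [arithmetic] -/
theorem pg4_rank_two_example : (1:ℤ) + 2 = 3 ∧ (2:ℤ) = 6 - 4 * 1 ∧ (-2:ℤ) = 6 - 4 * 2 := by norm_num

/-- **THEOREM KL-R2, the Chern-character equations of the rank-2 stratum (report §9.9 (i); machine-derived by Grothendieck–Riemann–Roch on the
small resolution `B̃₁ ×_{ℙ¹} B̃₂`, validated on five sheaves of known character).** For `F = 𝒪_{Σ_A}(W)`, `W ≡ a₁θ₁ + a₂θ₂ + Σ v_p V_p + Σ h_q H_q`,
the conditions `ch₂(i_*F) = θ²` and `ch₃(i_*F)[pt₁·θ₂] = 0` read `Sv1 = 6 − 4a₁` (with `a₁ + a₂ = 3`) and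
`8 − Sv1 − Sv2 − 4a₂ + a₂·Sv1 − 8a₁ + 4a₁a₂ + 2a₁² = 0` (`Svk = Σ_p v_p^k`); eliminating gives `Sv2 = 2a₁² − 6a₁ + 8`. [arithmetic] -/
theorem pg4_rank_two_ch3 (a₁ a₂ Sv1 Sv2 : ℤ) (h12 : a₁ + a₂ = 3) (h1 : Sv1 = 6 - 4 * a₁)
    (h3 : 8 - Sv1 - Sv2 - 4 * a₂ + a₂ * Sv1 - 8 * a₁ + 4 * a₁ * a₂ + 2 * a₁ ^ 2 = 0) : Sv2 = 2 * a₁ ^ 2 - 6 * a₁ + 8 := by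
  have ha2 : a₂ = 3 - a₁ := by omega
  subst ha2; subst h1; nlinarith [h3]

/-- **THEOREM KL-R2, the parity contradiction (report §9.9 (ii)).** ι-invariance pairs the eight base points of each pencil into four `±`-pairs
with equal coefficients, so `Sv1 = 2(x₁ + x₂ + x₃ + x₄)` and `Sv2 = 2(x₁² + x₂² + x₃² + x₄²)`. Then `Sv1 = 6 − 4a₁` and `Sv2 = 2a₁² − 6a₁ + 8` say
`Σ x_i = 3 − 2a₁` (odd) and `Σ x_i² = a₁² − 3a₁ + 4 = a₁(a₁ − 3) + 4` (even), contradicting `x² ≡ x (mod 2)`: **no ι-invariant reflexive rank-one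
sheaf on a general rank-2 support Σ_A has Chern character W.** [elementary; the load-bearing arithmetic of KL-R2] -/
theorem pg4_rank_two_parity (a x y z w : ℤ) (hsum : x + y + z + w = 3 - 2 * a) :
    x ^ 2 + y ^ 2 + z ^ 2 + w ^ 2 ≠ a ^ 2 - 3 * a + 4 := by
  intro heq
  obtain ⟨mx, hx⟩ := Int.even_mul_succ_self (x - 1)
  obtain ⟨my, hy⟩ := Int.even_mul_succ_self (y - 1)
  obtain ⟨mz, hz⟩ := Int.even_mul_succ_self (z - 1)
  obtain ⟨mw, hw⟩ := Int.even_mul_succ_self (w - 1)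
  obtain ⟨n, hn⟩ := Int.even_mul_succ_self a
  have ex : x ^ 2 = mx + mx + x := by linear_combination hx
  have ey : y ^ 2 = my + my + y := by linear_combination hy
  have ez : z ^ 2 = mz + mz + z := by linear_combination hz
  have ew : w ^ 2 = mw + mw + w := by linear_combination hw
  have ea : a ^ 2 = n + n - a := by linear_combination hn
  have key : (mx + mx + x) + (my + my + y) + (mz + mz + z) + (mw + mw + w) = (n + n - a) - 3 * a + 4 := by
    rw [← ex, ← ey, ← ez, ← ew, ← ea]; exact heq
  omega

/-- **The non-reflexive residual of the rank-2 stratum (report §9.9 (iii)).** For `F ⊊ F^{∨∨} = 𝒪_{Σ_A}(W)` with quotient supported on curves,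
`ch₃(F) = ch₃(F^{∨∨}) − [curves]`, and with the pair structure `ch₃(F^{∨∨})[pt₁·θ₂] = 2(a₁² − 3a₁ + 4) − Sv2 ≡ 0 − 2 ≡ 2 (mod 4)`: the cosupport class
has both coefficients `≡ 2 (mod 4)`, in particular `≥ 2`. Arithmetic core: `2·(even) − 2·(odd) ≡ 2 (mod 4)`. [elementary] -/
theorem pg4_rank_two_cosupport (e o : ℤ) (he : Even e) (ho : Odd o) : (2 * e - 2 * o) % 4 = 2 := by
  obtain ⟨k, hk⟩ := he; obtain ⟨l, hl⟩ := ho; subst hk; subst hl; omega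

end ProductGroundFourKL

end Summit.HodgeConjecture.HodgeConjecture.WeilTypeLadder
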